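import Mathlib

/-!
# Jacobi's complementary-minor theorem for principal blocks

Stub `stub_jacobiComplementaryMinor` of crux `stmt-QuantumFields-9151`
(`Summit.QuantumFields.QCD.Theses.PauliWegnerSea.PhaseQuenchedFlavourDecay`,
line `crossing-split-integrability`).

For an invertible square matrix `M` over `ℂ` and a splitting of its index type into a principal
block enumerated by `I : Fin r → n` and the complementary block enumerated by `J : Fin k → n`
(both injective, with disjoint and jointly exhaustive ranges), Jacobi's theorem on complementary
minors (Horn–Johnson, *Matrix Analysis*, §0.8.4) in Schur-complement form reads
`det ((M⁻¹)[I, I]) * det M = det (M[J, J])`,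
provided the complementary principal minor `det (M[J, J])` is non-zero: the principal minors of
the inverse are the complementary principal minors of `M` divided by `det M`.

Proof: reindex `M` along the bijection `Sum.elim I J : Fin r ⊕ Fin k ≃ n` into the block matrix
`fromBlocks A B C D` with `D = M[J, J]`; by the block-inverse formula
(`Matrix.invOf_fromBlocks₂₂_eq`) the `₁₁` block of its inverse is the inverse of the Schur
complement `A - B ⅟D C`, while `det (fromBlocks A B C D) = det D * det (A - B ⅟D C)`
(`Matrix.det_fromBlocks₂₂`).
-/

noncomputable section

namespace Summit.QuantumFields.QCD.Cruxes.PhaseQuenchedFlavourDecay.CrossingSplitIntegrability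

/-- **Jacobi's complementary-minor theorem** (principal blocks, Schur-complement form).
If `I : Fin r → n` and `J : Fin k → n` are injective enumerations with disjoint ranges covering
`n`, `det M ≠ 0` and `det (M[J, J]) ≠ 0`, then `det ((M⁻¹)[I, I]) * det M = det (M[J, J])`. -/
theorem stub_jacobiComplementaryMinor :
    ∀ (n : Type) [Fintype n] [DecidableEq n] (r k : ℕ) (M : Matrix n n ℂ) (I : Fin r → n) (J : Fin k → n),
      Function.Injective I → Function.Injective J → (∀ a b, I a ≠ J b) → (∀ x, (∃ a, I a = x) ∨ (∃ b, J b = x)) →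
      M.det ≠ 0 → (M.submatrix J J).det ≠ 0 → ((M⁻¹).submatrix I I).det * M.det = (M.submatrix J J).det := by
  intro n _ _ r k M I J hI hJ hIJ hcov hM hMJ
  -- the joint enumeration `Sum.elim I J` is a bijection `Fin r ⊕ Fin k ≃ n`
  have hbij : Function.Bijective (Sum.elim I J) := by
    refine ⟨hI.sumElim hJ hIJ, fun x => ?_⟩
    rcases hcov x with ⟨a, ha⟩ | ⟨b, hb⟩
    · exact ⟨Sum.inl a, ha⟩
    · exact ⟨Sum.inr b, hb⟩
  obtain ⟨e, he⟩ : ∃ e : Fin r ⊕ Fin k ≃ n, ⇑e = Sum.elim I J :=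
    ⟨Equiv.ofBijective _ hbij, rfl⟩
  -- the four blocks of `M` in the reindexed coordinates
  set A : Matrix (Fin r) (Fin r) ℂ := M.submatrix I I with hA
  set B : Matrix (Fin r) (Fin k) ℂ := M.submatrix I J with hB
  set C : Matrix (Fin k) (Fin r) ℂ := M.submatrix J I with hC
  set D : Matrix (Fin k) (Fin k) ℂ := M.submatrix J J with hD
  have hblock : M.submatrix e e = Matrix.fromBlocks A B C D := by
    ext (i | i) (j | j) <;> simp [he, hA, hB, hC, hD]
  -- reindexing preserves the determinant
  have hdet : (Matrix.fromBlocks A B C D).det = M.det := by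
    rw [← hblock, Matrix.det_submatrix_equiv_self]
  -- the principal `I`-block of `M⁻¹` is the `₁₁` block of the inverse block matrix
  have hinv : (M⁻¹).submatrix I I = ((Matrix.fromBlocks A B C D)⁻¹).toBlocks₁₁ := by
    rw [← hblock, Matrix.inv_submatrix_equiv]
    ext a b
    simp [Matrix.toBlocks₁₁, he]
  -- invertibility of `D`, of the block matrix, and hence of the Schur complement
  have hM' : (Matrix.fromBlocks A B C D).det ≠ 0 := by rwa [hdet]
  letI iD : Invertible D := Matrix.invertibleOfIsUnitDet D (isUnit_iff_ne_zero.mpr hMJ)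
  letI iABCD : Invertible (Matrix.fromBlocks A B C D) :=
    Matrix.invertibleOfIsUnitDet _ (isUnit_iff_ne_zero.mpr hM')
  letI iS : Invertible (A - B * ⅟D * C) := Matrix.invertibleOfFromBlocks₂₂Invertible A B C D
  -- block-inverse formula: the `₁₁` block of the inverse is the inverse Schur complement
  have hinv₁₁ : ((Matrix.fromBlocks A B C D)⁻¹).toBlocks₁₁ = ⅟(A - B * ⅟D * C) := by
    rw [← Matrix.invOf_eq_nonsing_inv, Matrix.invOf_fromBlocks₂₂_eq,
      Matrix.toBlocks_fromBlocks₁₁]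
  have hSS : (⅟(A - B * ⅟D * C)).det * (A - B * ⅟D * C).det = 1 := by
    rw [← Matrix.det_mul, invOf_mul_self, Matrix.det_one]
  rw [hinv, hinv₁₁, ← hdet, Matrix.det_fromBlocks₂₂, mul_left_comm, hSS, mul_one]

end Summit.QuantumFields.QCD.Cruxes.PhaseQuenchedFlavourDecay.CrossingSplitIntegrability
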